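import Mathlib
import Summits.CriticalPhenomena.PercolationContinuityZ3.Theorems.PercNearOneGluingNoHeavyLowerTailOrientedAntipodalHallCyclicMSSym

/-!
# Cyclic selections: the Hall count from the DOWN-CLOSED three-family inequality `MS3-down`

Helper file for crux `stmt-CriticalPhenomena-4575` (`NoHeavyLowerTail`, route `PercNearOneGluingNoHeavy`),
new-inequality factory seat `prim-ineq-gen-3` (gen 8).  Everything here is PROVED; the open combinatorial
inequality enters as a HYPOTHESIS, in a form that is strictly WEAKER (easier to discharge) than the
hypotheses of `card_le_card_goods_above_cyclic` (gen 5, `MS3-cyc`) and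
`card_le_card_goods_above_cyclic_of_sym` (gen 7, `MS3-sym`).

Observation (gen 8).  The good sets of a monotone labeling `f` — `f U = top`, `f (S \ U) = bot` — form an
UP-SET inside `S`, and "`U` contains a bad" is upward closed too.  Hence the capacity-one Hall count for a
cyclic selection `(i,j), (j,l), (l,i)` only needs a lower bound on the number of sets `F ⊆ S` lying INSIDE
some explicit co-good, and the explicit co-goods may include, besides the within-family differences and the
cross meets of the complement families `P, Q, R`, all *double differences* `U \ (V ∪ W)` (`U ∈ P`, `V ∈ Q`,
`W ∈ R`, and cyclically): their complements `X ∪ (S \ Y) ∪ (S \ Z)` lie above the petals `C_i` (from `X`) and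
`C_l` (from `S \ Y`), their traces `(Y ∩ Z) \ X` lie below `C_j` and `C_l`.  So the Hall count follows from

> `MS3-down`: for three families `P, Q, R` of subsets of `S`, pairwise intersecting, pairwise co-intersecting
> in `S` and cross-incomparable (`LAB=1`),
> `#P + #Q + #R ≤ #{F ⊆ S : F ⊆ T for some T ∈ (P \\ P ∪ Q \\ Q ∪ R \\ R) ∪ (P ⊼ Q ∪ Q ⊼ R ∪ R ⊼ P) ∪ DD}`,
> `DD = {U \ (V ∪ W)}` over one member from each family.

Every collapse difference of `MS3-sym` is a double difference (`U ∩ V = U ∩ W` gives `U \ V = U \ (V ∪ W)`), so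
`K_sym ⊆ (differences ∪ meets ∪ DD)` and `MS3-sym ⟹ MS3-down`; the down-closure and the unconditioned `DD`
block make `MS3-down` genuinely weaker (e.g. for the sunflower `{145}|{245}|{345}` the counted family is
`{∅,1,2,3,4,5,45}` against `K_sym = {∅,45,1,2,3}`).  Equivalently (memo COMB.md §3c (xxi)): a set `F` inside some
member is counted unless the members containing `F` all lie in ONE family and the members disjoint from `F` all
lie in at most one OTHER family — the 'hexagon' description of the certifiable goods.  Exhaustive census
(n ≤ 6, m ≤ 7: 15.5 M labelled `LAB=1` instances) finds slack ≥ 1 everywhere; no proof is known.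
(prim-ineq-gen-3 gen 8, 2026-08-20; memo `run/shared/lean/prim/prim-ineq-gen-3/MS3-STATE.md` §7.)
-/

namespace Summit.CriticalPhenomena.PercolationContinuityZ3.Theorems

namespace OrientedAntipodalHall

open Finset AntipodalStrongHarris AntipodalStrongHarris.Lab
open scoped FinsetFamily

variable {α : Type*} [DecidableEq α] {k : ℕ}

/-- Certification of a good set from label witnesses: if `S \ F` contains two sets with different petal
labels and `F` lies inside two sets with different petal labels, then `S \ F` is good
(`f (S \ F) = top`, `f (S \ (S \ F)) = f F = bot`). -/
theorem good_sdiff_of_witnesses (S : Finset α) {f : Finset α → Lab k}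
    (hf : ∀ ⦃X Y : Finset α⦄, X ⊆ Y → f X ≤ f Y) {F U₁ U₂ V₁ V₂ : Finset α} {a b c d : Fin k}
    (hFS : F ⊆ S) (hab : a ≠ b) (hcd : c ≠ d)
    (hU₁ : f U₁ = petal a) (hU₂ : f U₂ = petal b) (h₁ : U₁ ⊆ S \ F) (h₂ : U₂ ⊆ S \ F)
    (hV₁ : f V₁ = petal c) (hV₂ : f V₂ = petal d) (h₃ : F ⊆ V₁) (h₄ : F ⊆ V₂) :
    f (S \ F) = top ∧ f (S \ (S \ F)) = bot := by
  refine ⟨eq_top_of_petal_le hab ?_ ?_, ?_⟩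
  · rw [← hU₁]; exact hf h₁
  · rw [← hU₂]; exact hf h₂
  · rw [Finset.sdiff_sdiff_eq_self hFS]
    refine eq_bot_of_le_petal hcd ?_ ?_
    · rw [← hV₁]; exact hf h₃
    · rw [← hV₂]; exact hf h₄

/-- If `F ⊆ S \ A` and `A ⊆ S` then `A ⊆ S \ F`. -/
theorem subset_sdiff_of_subset_sdiff' {S A F : Finset α} (hAS : A ⊆ S) (h : F ⊆ S \ A) :
    A ⊆ S \ F :=
  fun _ hx => mem_sdiff.mpr ⟨hAS hx, fun hxF => (mem_sdiff.mp (h hxF)).2 hx⟩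

/-- Unpacking `F ⊆ (S \ A) \ (S \ B)`: `F ⊆ S \ A` and `F ⊆ B`. -/
theorem subset_of_subset_sdiff_sdiff {S A B F : Finset α} (h : F ⊆ (S \ A) \ (S \ B)) :
    F ⊆ S \ A ∧ F ⊆ B := by
  refine ⟨fun _ hx => (mem_sdiff.mp (h hx)).1, fun x hx => ?_⟩
  have hx' := mem_sdiff.mp (h hx)
  by_contra hxB
  exact hx'.2 (mem_sdiff.mpr ⟨(mem_sdiff.mp hx'.1).1, hxB⟩)

/-- Unpacking `F ⊆ (S \ A) \ ((S \ B) ∪ (S \ C))`: `F ⊆ S \ A`, `F ⊆ B` and `F ⊆ C`. -/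
theorem subset_of_subset_sdiff_union_sdiff {S A B C F : Finset α}
    (h : F ⊆ (S \ A) \ ((S \ B) ∪ (S \ C))) : F ⊆ S \ A ∧ F ⊆ B ∧ F ⊆ C := by
  refine ⟨fun _ hx => (mem_sdiff.mp (h hx)).1, fun x hx => ?_, fun x hx => ?_⟩
  · have hx' := mem_sdiff.mp (h hx)
    by_contra hxB
    exact hx'.2 (mem_union_left _ (mem_sdiff.mpr ⟨(mem_sdiff.mp hx'.1).1, hxB⟩))
  · have hx' := mem_sdiff.mp (h hx)
    by_contra hxC
    exact hx'.2 (mem_union_right _ (mem_sdiff.mpr ⟨(mem_sdiff.mp hx'.1).1, hxC⟩))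

/-- **Cyclic selections: Hall count from the down-closed three-family inequality `MS3-down`.**  Let `f` be a
sunflower labeling and `D₁, D₂, D₃` families of antipodal bads inside `S` of the cyclic types `(i,j)`, `(j,l)`,
`(l,i)` (`i, j, l` distinct).  Assume `MS3-down` for three families of subsets of `S` under the `LAB=1`
hypotheses (all pairs intersecting and co-intersecting in `S`, cross pairs incomparable): `#P + #Q + #R` is at
most the number of subsets of `S` lying inside some within-family difference, cross meet, or double difference
`U \ (V ∪ W)` (one member from each family).  Then at least `#D₁ + #D₂ + #D₃` good sets `U ⊆ S` contain a
member of `D₁ ∪ D₂ ∪ D₃`.  (Applied to the complement families `{S \ X : X ∈ D_t}`; the complement in `S` of every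
counted `F` is a good set above a bad, because goods and 'contains a bad' are upward closed.) -/
theorem card_le_card_goods_above_cyclic_of_down (S : Finset α) {f : Finset α → Lab k}
    (hf : ∀ ⦃X Y : Finset α⦄, X ⊆ Y → f X ≤ f Y) (D₁ D₂ D₃ : Finset (Finset α)) {i j l : Fin k}
    (hij : i ≠ j) (hjl : j ≠ l) (hil : i ≠ l)
    (h₁S : ∀ X ∈ D₁, X ⊆ S) (h₁i : ∀ X ∈ D₁, f X = petal i) (h₁j : ∀ X ∈ D₁, f (S \ X) = petal j)
    (h₂S : ∀ X ∈ D₂, X ⊆ S) (h₂j : ∀ X ∈ D₂, f X = petal j) (h₂l : ∀ X ∈ D₂, f (S \ X) = petal l)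
    (h₃S : ∀ X ∈ D₃, X ⊆ S) (h₃l : ∀ X ∈ D₃, f X = petal l) (h₃i : ∀ X ∈ D₃, f (S \ X) = petal i)
    (hMS3down : ∀ P Q R : Finset (Finset α),
      (∀ U ∈ P ∪ Q ∪ R, U ⊆ S) →
      (∀ U ∈ P ∪ Q ∪ R, ∀ U' ∈ P ∪ Q ∪ R, (U ∩ U').Nonempty) →
      (∀ U ∈ P ∪ Q ∪ R, ∀ U' ∈ P ∪ Q ∪ R, U ∪ U' ≠ S) →
      (∀ U ∈ P, ∀ U' ∈ Q, ¬ U ⊆ U' ∧ ¬ U' ⊆ U) →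
      (∀ U ∈ Q, ∀ U' ∈ R, ¬ U ⊆ U' ∧ ¬ U' ⊆ U) →
      (∀ U ∈ R, ∀ U' ∈ P, ¬ U ⊆ U' ∧ ¬ U' ⊆ U) →
      #P + #Q + #R ≤
        #{F ∈ S.powerset | ∃ T ∈ (P \\ P ∪ Q \\ Q ∪ R \\ R) ∪ (P ⊼ Q ∪ Q ⊼ R ∪ R ⊼ P) ∪
            (((P ×ˢ (Q ×ˢ R)).image fun p : Finset α × (Finset α × Finset α) => p.1 \ (p.2.1 ∪ p.2.2)) ∪
             ((Q ×ˢ (R ×ˢ P)).image fun p : Finset α × (Finset α × Finset α) => p.1 \ (p.2.1 ∪ p.2.2)) ∪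
             ((R ×ˢ (P ×ˢ Q)).image fun p : Finset α × (Finset α × Finset α) => p.1 \ (p.2.1 ∪ p.2.2))), F ⊆ T}) :
    #D₁ + #D₂ + #D₃ ≤
      #{U ∈ S.powerset | f U = top ∧ f (S \ U) = bot ∧ ∃ X ∈ D₁ ∪ D₂ ∪ D₃, X ⊆ U} := by
  -- the complement families
  set P : Finset (Finset α) := D₁.image (S \ ·) with hPdef
  set Q : Finset (Finset α) := D₂.image (S \ ·) with hQdef
  set R : Finset (Finset α) := D₃.image (S \ ·) with hRdef
  -- complementation is injective on subsets of `S`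
  have hinj : ∀ D : Finset (Finset α), (∀ X ∈ D, X ⊆ S) → #(D.image (S \ ·)) = #D := by
    intro D hD
    apply card_image_of_injOn
    intro X hX Y hY hXY
    have e₁ := Finset.sdiff_sdiff_eq_self (hD X hX)
    have e₂ := Finset.sdiff_sdiff_eq_self (hD Y hY)
    simp only at hXY
    rw [← e₁, ← e₂, hXY]
  have hcP : #P = #D₁ := by rw [hPdef]; exact hinj D₁ h₁S
  have hcQ : #Q = #D₂ := by rw [hQdef]; exact hinj D₂ h₂S
  have hcR : #R = #D₃ := by rw [hRdef]; exact hinj D₃ h₃S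
  -- every member of `P ∪ Q ∪ R` is the complement of a typed bad; types encoded by `s : Fin 3`
  have typed : ∀ U ∈ P ∪ Q ∪ R, ∃ X : Finset α, X ⊆ S ∧ U = S \ X ∧ ∃ s : Fin 3,
      f X = petal (![i, j, l] s) ∧ f (S \ X) = petal (![j, l, i] s) := by
    intro U hU
    rcases mem_union.mp hU with hU | hU
    · rcases mem_union.mp hU with hU | hU
      · obtain ⟨X, hX, rfl⟩ := mem_image.mp hU
        exact ⟨X, h₁S X hX, rfl, 0, by simpa using h₁i X hX, by simpa using h₁j X hX⟩
      · obtain ⟨X, hX, rfl⟩ := mem_image.mp hU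
        exact ⟨X, h₂S X hX, rfl, 1, by simpa using h₂j X hX, by simpa using h₂l X hX⟩
    · obtain ⟨X, hX, rfl⟩ := mem_image.mp hU
      exact ⟨X, h₃S X hX, rfl, 2, by simpa using h₃l X hX, by simpa using h₃i X hX⟩
  -- no two cyclic types are opposite
  have hnotopp : ∀ s t : Fin 3, ¬ (![j, l, i] s = ![i, j, l] t ∧ ![j, l, i] t = ![i, j, l] s) := by
    intro s t
    fin_cases s <;> fin_cases t <;> simp [hij, hjl, hil, hij.symm, hjl.symm, hil.symm]
  have hnotopp' : ∀ s t : Fin 3, ¬ (![i, j, l] s = ![j, l, i] t ∧ ![i, j, l] t = ![j, l, i] s) := by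
    intro s t h
    exact hnotopp t s ⟨h.1.symm, h.2.symm⟩
  -- the `LAB=1` hypotheses for the complement families
  have hsub : ∀ U ∈ P ∪ Q ∪ R, U ⊆ S := by
    intro U hU
    obtain ⟨X, -, rfl, -⟩ := typed U hU
    exact sdiff_subset
  have hint : ∀ U ∈ P ∪ Q ∪ R, ∀ U' ∈ P ∪ Q ∪ R, (U ∩ U').Nonempty := by
    intro U hU U' hU'
    obtain ⟨X, -, rfl, s, hX, hSX⟩ := typed U hU
    obtain ⟨Y, -, rfl, t, hY, hSY⟩ := typed U' hU'
    exact compl_inter_compl_nonempty S hf hX hSX hY hSY (hnotopp s t)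
  have hcoint : ∀ U ∈ P ∪ Q ∪ R, ∀ U' ∈ P ∪ Q ∪ R, U ∪ U' ≠ S := by
    intro U hU U' hU'
    obtain ⟨X, hXS, rfl, s, hX, hSX⟩ := typed U hU
    obtain ⟨Y, hYS, rfl, t, hY, hSY⟩ := typed U' hU'
    exact compl_union_compl_ne S hf hXS hYS hX hSX hY hSY (hnotopp' s t)
  have hPQ : ∀ U ∈ P, ∀ U' ∈ Q, ¬ U ⊆ U' ∧ ¬ U' ⊆ U := by
    intro U hU U' hU'
    obtain ⟨X, hX, rfl⟩ := mem_image.mp hU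
    obtain ⟨Y, hY, rfl⟩ := mem_image.mp hU'
    exact ⟨not_compl_subset_compl S hf (h₂S Y hY) (h₁i X hX) (h₂j Y hY) hij,
      not_compl_subset_compl S hf (h₁S X hX) (h₂j Y hY) (h₁i X hX) hij.symm⟩
  have hQR : ∀ U ∈ Q, ∀ U' ∈ R, ¬ U ⊆ U' ∧ ¬ U' ⊆ U := by
    intro U hU U' hU'
    obtain ⟨Y, hY, rfl⟩ := mem_image.mp hU
    obtain ⟨Z, hZ, rfl⟩ := mem_image.mp hU'
    exact ⟨not_compl_subset_compl S hf (h₃S Z hZ) (h₂j Y hY) (h₃l Z hZ) hjl,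
      not_compl_subset_compl S hf (h₂S Y hY) (h₃l Z hZ) (h₂j Y hY) hjl.symm⟩
  have hRP : ∀ U ∈ R, ∀ U' ∈ P, ¬ U ⊆ U' ∧ ¬ U' ⊆ U := by
    intro U hU U' hU'
    obtain ⟨Z, hZ, rfl⟩ := mem_image.mp hU
    obtain ⟨X, hX, rfl⟩ := mem_image.mp hU'
    exact ⟨not_compl_subset_compl S hf (h₁S X hX) (h₃l Z hZ) (h₁i X hX) hil.symm,
      not_compl_subset_compl S hf (h₃S Z hZ) (h₁i X hX) (h₃l Z hZ) hil⟩
  have hPQR := hMS3down P Q R hsub hint hcoint hPQ hQR hRP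
  -- the counted down-closed family
  set 𝒢 : Finset (Finset α) :=
    {F ∈ S.powerset | ∃ T ∈ (P \\ P ∪ Q \\ Q ∪ R \\ R) ∪ (P ⊼ Q ∪ Q ⊼ R ∪ R ⊼ P) ∪
        (((P ×ˢ (Q ×ˢ R)).image fun p : Finset α × (Finset α × Finset α) => p.1 \ (p.2.1 ∪ p.2.2)) ∪
         ((Q ×ˢ (R ×ˢ P)).image fun p : Finset α × (Finset α × Finset α) => p.1 \ (p.2.1 ∪ p.2.2)) ∪
         ((R ×ˢ (P ×ˢ Q)).image fun p : Finset α × (Finset α × Finset α) => p.1 \ (p.2.1 ∪ p.2.2))), F ⊆ T} with h𝒢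
  -- every counted `F` has a good complement above a bad
  have hmem : ∀ F ∈ 𝒢, F ⊆ S ∧ f (S \ F) = top ∧ f (S \ (S \ F)) = bot ∧
      ∃ X ∈ D₁ ∪ D₂ ∪ D₃, X ⊆ S \ F := by
    intro F hF
    rw [h𝒢, mem_filter, mem_powerset] at hF
    obtain ⟨hFS, T, hT, hFT⟩ := hF
    have mem₁ : ∀ X ∈ D₁, X ∈ D₁ ∪ D₂ ∪ D₃ := fun X hX => mem_union_left _ (mem_union_left _ hX)
    have mem₂ : ∀ Y ∈ D₂, Y ∈ D₁ ∪ D₂ ∪ D₃ := fun Y hY => mem_union_left _ (mem_union_right _ hY)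
    have mem₃ : ∀ Z ∈ D₃, Z ∈ D₁ ∪ D₂ ∪ D₃ := fun Z hZ => mem_union_right _ hZ
    simp only [mem_union] at hT
    rcases hT with (((hT | hT) | hT) | ((hT | hT) | hT)) | ((hT | hT) | hT)
    · -- P \\ P : T = (S \ X) \ (S \ X'), so F ⊆ S \ X and F ⊆ X'
      obtain ⟨U, hU, U', hU', rfl⟩ := mem_diffs.mp hT
      obtain ⟨X, hX, rfl⟩ := mem_image.mp hU
      obtain ⟨X', hX', rfl⟩ := mem_image.mp hU'
      obtain ⟨hFX, hFX'⟩ := subset_of_subset_sdiff_sdiff hFT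
      have hXF : X ⊆ S \ F := subset_sdiff_of_subset_sdiff' (h₁S X hX) hFX
      obtain ⟨h1, h2⟩ := good_sdiff_of_witnesses S hf hFS hij hij (h₁i X hX) (h₁j X' hX') hXF
        (sdiff_subset_sdiff le_rfl hFX') (h₁i X' hX') (h₁j X hX) hFX' hFX
      exact ⟨hFS, h1, h2, X, mem₁ X hX, hXF⟩
    · -- Q \\ Q
      obtain ⟨U, hU, U', hU', rfl⟩ := mem_diffs.mp hT
      obtain ⟨Y, hY, rfl⟩ := mem_image.mp hU
      obtain ⟨Y', hY', rfl⟩ := mem_image.mp hU'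
      obtain ⟨hFY, hFY'⟩ := subset_of_subset_sdiff_sdiff hFT
      have hYF : Y ⊆ S \ F := subset_sdiff_of_subset_sdiff' (h₂S Y hY) hFY
      obtain ⟨h1, h2⟩ := good_sdiff_of_witnesses S hf hFS hjl hjl (h₂j Y hY) (h₂l Y' hY') hYF
        (sdiff_subset_sdiff le_rfl hFY') (h₂j Y' hY') (h₂l Y hY) hFY' hFY
      exact ⟨hFS, h1, h2, Y, mem₂ Y hY, hYF⟩
    · -- R \\ R
      obtain ⟨U, hU, U', hU', rfl⟩ := mem_diffs.mp hT
      obtain ⟨Z, hZ, rfl⟩ := mem_image.mp hU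
      obtain ⟨Z', hZ', rfl⟩ := mem_image.mp hU'
      obtain ⟨hFZ, hFZ'⟩ := subset_of_subset_sdiff_sdiff hFT
      have hZF : Z ⊆ S \ F := subset_sdiff_of_subset_sdiff' (h₃S Z hZ) hFZ
      obtain ⟨h1, h2⟩ := good_sdiff_of_witnesses S hf hFS hil.symm hil.symm (h₃l Z hZ) (h₃i Z' hZ')
        hZF (sdiff_subset_sdiff le_rfl hFZ') (h₃l Z' hZ') (h₃i Z hZ) hFZ' hFZ
      exact ⟨hFS, h1, h2, Z, mem₃ Z hZ, hZF⟩
    · -- P ⊼ Q : T = (S \ X) ∩ (S \ Y)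
      obtain ⟨U, hU, U', hU', rfl⟩ := mem_infs.mp hT
      obtain ⟨X, hX, rfl⟩ := mem_image.mp hU
      obtain ⟨Y, hY, rfl⟩ := mem_image.mp hU'
      have hFX : F ⊆ S \ X := hFT.trans inter_subset_left
      have hFY : F ⊆ S \ Y := hFT.trans inter_subset_right
      have hXF : X ⊆ S \ F := subset_sdiff_of_subset_sdiff' (h₁S X hX) hFX
      have hYF : Y ⊆ S \ F := subset_sdiff_of_subset_sdiff' (h₂S Y hY) hFY
      obtain ⟨h1, h2⟩ := good_sdiff_of_witnesses S hf hFS hij hjl (h₁i X hX) (h₂j Y hY) hXF hYF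
        (h₁j X hX) (h₂l Y hY) hFX hFY
      exact ⟨hFS, h1, h2, X, mem₁ X hX, hXF⟩
    · -- Q ⊼ R
      obtain ⟨U, hU, U', hU', rfl⟩ := mem_infs.mp hT
      obtain ⟨Y, hY, rfl⟩ := mem_image.mp hU
      obtain ⟨Z, hZ, rfl⟩ := mem_image.mp hU'
      have hFY : F ⊆ S \ Y := hFT.trans inter_subset_left
      have hFZ : F ⊆ S \ Z := hFT.trans inter_subset_right
      have hYF : Y ⊆ S \ F := subset_sdiff_of_subset_sdiff' (h₂S Y hY) hFY
      have hZF : Z ⊆ S \ F := subset_sdiff_of_subset_sdiff' (h₃S Z hZ) hFZ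
      obtain ⟨h1, h2⟩ := good_sdiff_of_witnesses S hf hFS hjl hil.symm (h₂j Y hY) (h₃l Z hZ) hYF hZF
        (h₂l Y hY) (h₃i Z hZ) hFY hFZ
      exact ⟨hFS, h1, h2, Y, mem₂ Y hY, hYF⟩
    · -- R ⊼ P
      obtain ⟨U, hU, U', hU', rfl⟩ := mem_infs.mp hT
      obtain ⟨Z, hZ, rfl⟩ := mem_image.mp hU
      obtain ⟨X, hX, rfl⟩ := mem_image.mp hU'
      have hFZ : F ⊆ S \ Z := hFT.trans inter_subset_left
      have hFX : F ⊆ S \ X := hFT.trans inter_subset_right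
      have hZF : Z ⊆ S \ F := subset_sdiff_of_subset_sdiff' (h₃S Z hZ) hFZ
      have hXF : X ⊆ S \ F := subset_sdiff_of_subset_sdiff' (h₁S X hX) hFX
      obtain ⟨h1, h2⟩ := good_sdiff_of_witnesses S hf hFS hil.symm hij (h₃l Z hZ) (h₁i X hX)
        hZF hXF (h₃i Z hZ) (h₁j X hX) hFZ hFX
      exact ⟨hFS, h1, h2, Z, mem₃ Z hZ, hZF⟩
    · -- double difference of a `P`-member: T = (S \ X) \ ((S \ Y) ∪ (S \ Z)); F ⊆ S \ X, F ⊆ Y, F ⊆ Z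
      obtain ⟨⟨U, V, W'⟩, hp, rfl⟩ := mem_image.mp hT
      obtain ⟨hU, hVW⟩ := mem_product.mp hp
      obtain ⟨hV, hW'⟩ := mem_product.mp hVW
      obtain ⟨X, hX, rfl⟩ := mem_image.mp hU
      obtain ⟨Y, hY, rfl⟩ := mem_image.mp hV
      obtain ⟨Z, hZ, rfl⟩ := mem_image.mp hW'
      obtain ⟨hFX, hFY, hFZ⟩ := subset_of_subset_sdiff_union_sdiff hFT
      have hXF : X ⊆ S \ F := subset_sdiff_of_subset_sdiff' (h₁S X hX) hFX
      obtain ⟨h1, h2⟩ := good_sdiff_of_witnesses S hf hFS hil hjl (h₁i X hX) (h₂l Y hY) hXF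
        (sdiff_subset_sdiff le_rfl hFY) (h₂j Y hY) (h₃l Z hZ) hFY hFZ
      exact ⟨hFS, h1, h2, X, mem₁ X hX, hXF⟩
    · -- double difference of a `Q`-member: F ⊆ S \ Y, F ⊆ Z, F ⊆ X
      obtain ⟨⟨V, W', U⟩, hp, rfl⟩ := mem_image.mp hT
      obtain ⟨hV, hWU⟩ := mem_product.mp hp
      obtain ⟨hW', hU⟩ := mem_product.mp hWU
      obtain ⟨Y, hY, rfl⟩ := mem_image.mp hV
      obtain ⟨Z, hZ, rfl⟩ := mem_image.mp hW'
      obtain ⟨X, hX, rfl⟩ := mem_image.mp hU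
      obtain ⟨hFY, hFZ, hFX⟩ := subset_of_subset_sdiff_union_sdiff hFT
      have hYF : Y ⊆ S \ F := subset_sdiff_of_subset_sdiff' (h₂S Y hY) hFY
      obtain ⟨h1, h2⟩ := good_sdiff_of_witnesses S hf hFS hij.symm hil.symm (h₂j Y hY) (h₃i Z hZ) hYF
        (sdiff_subset_sdiff le_rfl hFZ) (h₃l Z hZ) (h₁i X hX) hFZ hFX
      exact ⟨hFS, h1, h2, Y, mem₂ Y hY, hYF⟩
    · -- double difference of an `R`-member: F ⊆ S \ Z, F ⊆ X, F ⊆ Y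
      obtain ⟨⟨W', U, V⟩, hp, rfl⟩ := mem_image.mp hT
      obtain ⟨hW', hUV⟩ := mem_product.mp hp
      obtain ⟨hU, hV⟩ := mem_product.mp hUV
      obtain ⟨Z, hZ, rfl⟩ := mem_image.mp hW'
      obtain ⟨X, hX, rfl⟩ := mem_image.mp hU
      obtain ⟨Y, hY, rfl⟩ := mem_image.mp hV
      obtain ⟨hFZ, hFX, hFY⟩ := subset_of_subset_sdiff_union_sdiff hFT
      have hZF : Z ⊆ S \ F := subset_sdiff_of_subset_sdiff' (h₃S Z hZ) hFZ
      obtain ⟨h1, h2⟩ := good_sdiff_of_witnesses S hf hFS hjl.symm hij (h₃l Z hZ) (h₁j X hX) hZF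
        (sdiff_subset_sdiff le_rfl hFX) (h₁i X hX) (h₂j Y hY) hFX hFY
      exact ⟨hFS, h1, h2, Z, mem₃ Z hZ, hZF⟩
  -- complementation is injective on `𝒢` and lands in the goods above `D₁ ∪ D₂ ∪ D₃`
  have hinj𝒢 : Set.InjOn (fun F => S \ F) (𝒢 : Set (Finset α)) := by
    intro F₁ hF₁ F₂ hF₂ h
    have e₁ := Finset.sdiff_sdiff_eq_self (hmem F₁ hF₁).1
    have e₂ := Finset.sdiff_sdiff_eq_self (hmem F₂ hF₂).1
    simp only at h
    rw [← e₁, ← e₂, h]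
  have himg : 𝒢.image (fun F => S \ F) ⊆
      {U ∈ S.powerset | f U = top ∧ f (S \ U) = bot ∧ ∃ X ∈ D₁ ∪ D₂ ∪ D₃, X ⊆ U} := by
    intro U hU
    obtain ⟨F, hF, rfl⟩ := mem_image.mp hU
    obtain ⟨-, h1, h2, hX⟩ := hmem F hF
    rw [mem_filter, mem_powerset]
    exact ⟨sdiff_subset, h1, h2, hX⟩
  calc #D₁ + #D₂ + #D₃ = #P + #Q + #R := by rw [hcP, hcQ, hcR]
    _ ≤ #𝒢 := hPQR
    _ = #(𝒢.image fun F => S \ F) := (card_image_of_injOn hinj𝒢).symm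
    _ ≤ _ := card_le_card himg

end OrientedAntipodalHall

end Summit.CriticalPhenomena.PercolationContinuityZ3.Theorems
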